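import Literature.Computability.QuantumComplexity.UncomputeBranches
import Literature.Computability.QuantumComplexity.CliffordTInverse
import HarnessLib

/-!
# Tidy subroutines: compute–copy–uncompute around a bounded-error quantum decider

Topic `Literature/Computability/QuantumComplexity`; second file of the discharge of the named
fact `Literature.Computability.Cryptography.isQSolvable_of_mem_BQP_oracle` (Bennett–Bernstein–
Brassard–Vazirani 1997, Cor. 4.15 `BQP^BQP = BQP`). This file PROVES the state-vector content
of their **Theorem 4.14** (tidy machines) in the tree's circuit model.

Given an oracle-free Clifford+T circuit `D` on `k + d` wires — a *decider*: run on `|q⟩|0^d⟩`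
it is measured on wire `0`, the answer being compared with `[q ∈ A]` — the **tidy block**
`tidyCirc D` on `(k + 1) + (k + d)` wires (query `q` on wires `0 … k-1`, answer wire `k`, then
a copy register of `k` wires and the `d` ancillas of `D`) is

  copy `q` into the copy register (CNOTs) · `D` on the last `k + d` wires · CNOT from the
  decider's answer wire onto wire `k` · `D⁻¹` (`QCircuit.inv`, `CliffordTInverse.lean`) ·
  copy again (uncopy),

BBBV's "running `M`, copying the answer to another track, and then running the reverse of
`M`" (proof of Thm. 4.14, p. 13 of arXiv:quant-ph/9701001), preceded by a copy of the input so
that the decider never touches the query register. **`tidyCirc_implOn`**: if on every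
classical query `q` the decider errs with probability at most `ε` (Born weight of the outcomes
whose wire `0` differs from `[q ∈ A]`), then on inputs whose copy register and ancillas read
`0` the tidy block is within `2√ε` of the XOR query gate `|q, b⟩ ↦ |q, b ⊕ [q ∈ A]⟩` (idle on
the other wires) in the sense of `ImplOn` (`ApproxImplementation.lean`):
`‖T ψ − (U_A ⊗ 1) ψ‖₂ ≤ 2√ε ‖ψ‖₂`. BBBV's computation (ibid.): the run–copy–reverse of a
decider that is right with probability `1 − ε` has overlap `≥ 1 − ε`-ish with the clean
configuration; here, per classical query `q` the error vector is
`(c₀ − c₁) · (|q, ā⟩ − |q, a⟩) ⊗ v_q` with `‖v_q‖² =` the error probability on `q`, and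
distinct queries give orthogonal errors (the query register is only read), whence the bound
`4ε ‖ψ‖²` on the squared norm with no loss in the number of queries in superposition.

## References

* C. H. Bennett, E. Bernstein, G. Brassard, U. Vazirani, *Strengths and weaknesses of quantum
  computing*, SIAM J. Comput. 26 (1997) 1510–1523, §4 (p. 11: "copy `f(x)` into safe storage,
  and then uncompute"), Thm. 4.14 and its proof (p. 13) [BennettBernsteinBrassardVazirani1997].
* M. A. Nielsen, I. L. Chuang, *Quantum Computation and Quantum Information*, CUP 2010, §3.2.5
  (uncomputation), §6.1.1 (the XOR oracle) [NielsenChuang2010].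
-/

noncomputable section

namespace Literature.Computability.QuantumComplexity

namespace TidyBlock

open Cryptography Matrix

variable {k d : ℕ}

/-! ### Layout -/

/-- The width of the tidy block: query `k`, answer `1`, copy `k`, decider ancillas `d`.
[folklore] -/
abbrev W (k d : ℕ) : ℕ := k + 1 + (k + d)

/-- Query wire `i`. [folklore] -/
def qW (i : Fin k) : Fin (W k d) := Fin.castAdd (k + d) (Fin.castSucc i)

/-- The answer wire `k`. [folklore] -/
def bW (k d : ℕ) : Fin (W k d) := Fin.castAdd (k + d) (Fin.last k)

/-- The decider's register (copy register, then its ancillas): wires `k + 1 …`. [folklore] -/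
def dE (k d : ℕ) : Fin (k + d) ↪ Fin (W k d) := Fin.natAddEmb (k + 1)

/-- The placement of the ideal query gate: the first `k + 1` wires. [folklore] -/
def oE (k d : ℕ) : Fin (k + 1) ↪ Fin (W k d) := Fin.castAddEmb (k + d)

/-- Layout bookkeeping. [folklore] -/
@[simp] theorem dE_apply (j : Fin (k + d)) : dE k d j = Fin.natAdd (k + 1) j := rfl

/-- Layout bookkeeping. [folklore] -/
@[simp] theorem oE_apply (j : Fin (k + 1)) : oE k d j = Fin.castAdd (k + d) j := rfl

/-- Layout bookkeeping. [folklore] -/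
theorem val_qW (i : Fin k) : ((qW (d := d) i : Fin (W k d)) : ℕ) = i := rfl

/-- Layout bookkeeping. [folklore] -/
theorem val_bW : ((bW k d : Fin (W k d)) : ℕ) = k := rfl

/-- Layout bookkeeping. [folklore] -/
theorem val_dE (j : Fin (k + d)) : ((dE k d j : Fin (W k d)) : ℕ) = k + 1 + j := rfl

/-- The register with query `q`, answer bit `b` and decider-register content `f`. [folklore] -/
def reg (q : QReg k) (b : Bool) (f : QReg (k + d)) : QReg (W k d) :=
  Fin.append (Fin.append q fun _ : Fin 1 => b) f

/-- Layout bookkeeping. [folklore] -/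
@[simp] theorem reg_qW (q : QReg k) (b : Bool) (f : QReg (k + d)) (i : Fin k) : reg q b f (qW i) = q i := by
  simp [reg, qW, Fin.castSucc]

/-- Layout bookkeeping. [folklore] -/
@[simp] theorem reg_bW (q : QReg k) (b : Bool) (f : QReg (k + d)) : reg q b f (bW k d) = b := by
  rw [reg, bW, show Fin.last k = Fin.natAdd k (0 : Fin 1) from Fin.ext rfl, Fin.append_left, Fin.append_right]

/-- Layout bookkeeping. [folklore] -/
@[simp] theorem reg_dE (q : QReg k) (b : Bool) (f : QReg (k + d)) (j : Fin (k + d)) : reg q b f (dE k d j) = f j := by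
  simp [reg]

/-- Layout bookkeeping. [folklore] -/
theorem reg_comp_dE (q : QReg k) (b : Bool) (f : QReg (k + d)) : reg q b f ∘ dE k d = f :=
  funext fun j => reg_dE q b f j

/-- The query content of a register. [folklore] -/
def query (z : QReg (W k d)) : QReg k := fun i => z (qW i)

/-- Layout bookkeeping. [folklore] -/
@[simp] theorem query_reg (q : QReg k) (b : Bool) (f : QReg (k + d)) : query (reg q b f) = q :=
  funext fun i => reg_qW q b f i

/-- Trichotomy of wires: query wire, answer wire, or decider wire. [folklore] -/
theorem wire_cases (w : Fin (W k d)) :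
    (∃ i : Fin k, w = qW i) ∨ w = bW k d ∨ ∃ j : Fin (k + d), w = dE k d j := by
  rcases Nat.lt_or_ge (w : ℕ) k with h | h
  · exact Or.inl ⟨⟨w, h⟩, Fin.ext rfl⟩
  · rcases Nat.lt_or_ge (w : ℕ) (k + 1) with h' | h'
    · exact Or.inr (Or.inl (Fin.ext (by rw [val_bW]; omega)))
    · exact Or.inr (Or.inr ⟨⟨(w : ℕ) - (k + 1), by have := w.isLt; unfold W at this; omega⟩,
        Fin.ext (by rw [val_dE]; simp; omega)⟩)

/-- A register is determined by its query, answer and decider parts. [folklore] -/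
theorem reg_eta (z : QReg (W k d)) : reg (query z) (z (bW k d)) (z ∘ dE k d) = z := by
  funext w
  rcases wire_cases w with ⟨i, rfl⟩ | rfl | ⟨j, rfl⟩
  · rw [reg_qW]; rfl
  · rw [reg_bW]
  · rw [reg_dE]; rfl

/-- Layout bookkeeping. [folklore] -/
theorem qW_ne_bW (i : Fin k) : (qW i : Fin (W k d)) ≠ bW k d := by
  intro h; have := congrArg Fin.val h; rw [val_qW, val_bW] at this; exact absurd this (ne_of_lt i.isLt)

/-- Layout bookkeeping. [folklore] -/
theorem qW_ne_dE (i : Fin k) (j : Fin (k + d)) : (qW i : Fin (W k d)) ≠ dE k d j := by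
  intro h; have := congrArg Fin.val h; rw [val_qW, val_dE] at this; have := i.isLt; omega

/-- Layout bookkeeping. [folklore] -/
theorem bW_ne_dE (j : Fin (k + d)) : bW k d ≠ dE k d j := by
  intro h; have := congrArg Fin.val h; rw [val_bW, val_dE] at this; omega

/-- Layout bookkeeping. [folklore] -/
theorem bW_notMem_range_dE : bW k d ∉ Set.range (dE k d) := by
  rintro ⟨j, hj⟩; exact bW_ne_dE j hj.symm

/-- Layout bookkeeping. [folklore] -/
theorem qW_notMem_range_dE (i : Fin k) : (qW i : Fin (W k d)) ∉ Set.range (dE k d) := by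
  rintro ⟨j, hj⟩; exact qW_ne_dE i j hj.symm

/-- Two registers agree off the decider register iff they have the same query and answer.
[folklore] -/
theorem agreeOff_dE_iff (z c : QReg (W k d)) :
    AgreeOff (dE k d) z c ↔ query z = query c ∧ z (bW k d) = c (bW k d) := by
  constructor
  · intro h
    exact ⟨funext fun i => h _ (qW_notMem_range_dE i), h _ bW_notMem_range_dE⟩
  · rintro ⟨hq, hb⟩ w hw
    rcases wire_cases w with ⟨i, rfl⟩ | rfl | ⟨j, rfl⟩
    · exact congrFun hq i
    · exact hb
    · exact absurd ⟨j, rfl⟩ hw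

/-- Layout bookkeeping. [folklore] -/
theorem agreeOff_reg_iff (z : QReg (W k d)) (q : QReg k) (b : Bool) (g : QReg (k + d)) :
    AgreeOff (dE k d) z (reg q b g) ↔ query z = q ∧ z (bW k d) = b := by
  rw [agreeOff_dE_iff, query_reg, reg_bW]

/-- Writing the decider register of `reg q b g`. [folklore] -/
theorem extend_dE_reg (f : QReg (k + d)) (q : QReg k) (b : Bool) (g : QReg (k + d)) :
    Function.extend (dE k d) f (reg q b g) = reg q b f := by
  rw [extend_eq_iff]
  exact ⟨reg_comp_dE q b f, (agreeOff_reg_iff _ q b g).2 ⟨query_reg q b f, reg_bW q b f⟩⟩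

/-- Updating the answer wire. [folklore] -/
theorem update_reg_bW (q : QReg k) (b b' : Bool) (f : QReg (k + d)) :
    Function.update (reg q b f) (bW k d) b' = reg q b' f := by
  funext w
  rcases eq_or_ne w (bW k d) with rfl | hw
  · rw [Function.update_self, reg_bW]
  · rw [Function.update_of_ne hw]
    rcases wire_cases w with ⟨i, rfl⟩ | rfl | ⟨j, rfl⟩
    · rw [reg_qW, reg_qW]
    · exact absurd rfl hw
    · rw [reg_dE, reg_dE]

/-- Updating a decider wire. [folklore] -/
theorem update_reg_dE (q : QReg k) (b : Bool) (f : QReg (k + d)) (j : Fin (k + d)) (v : Bool) :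
    Function.update (reg q b f) (dE k d j) v = reg q b (Function.update f j v) := by
  funext w
  rcases eq_or_ne w (dE k d j) with rfl | hw
  · rw [Function.update_self, reg_dE, Function.update_self]
  · rw [Function.update_of_ne hw]
    rcases wire_cases w with ⟨i, rfl⟩ | rfl | ⟨j', rfl⟩
    · rw [reg_qW, reg_qW]
    · rw [reg_bW, reg_bW]
    · rw [reg_dE, reg_dE, Function.update_of_ne]
      intro hjj; exact hw (by rw [hjj])

/-- `reg` is injective. [folklore] -/
theorem reg_injective_iff (q q' : QReg k) (b b' : Bool) (f f' : QReg (k + d)) :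
    reg q b f = reg q' b' f' ↔ q = q' ∧ b = b' ∧ f = f' := by
  constructor
  · intro h
    refine ⟨?_, ?_, ?_⟩
    · rw [← query_reg q b f, h, query_reg]
    · rw [← reg_bW q b f, h, reg_bW]
    · rw [← reg_comp_dE q b f, h, reg_comp_dE]
  · rintro ⟨rfl, rfl, rfl⟩; rfl

/-! ### The tidy block -/

/-- The copy operations: CNOT from query wire `i` onto copy wire `i` (decider wire `i`), for
every `i < k`. [cite: BennettBernsteinBrassardVazirani1997, §4 (copy into safe storage)] -/
def copyOpsOf (l : List (Fin k)) : List (RevOp (W k d)) :=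
  l.map fun i => RevOp.cnot (qW i) (dE k d (Fin.castAdd d i)) (qW_ne_dE i _)

/-- All the copy operations. [folklore] -/
def copyOps (k d : ℕ) : List (RevOp (W k d)) := copyOpsOf (List.finRange k)

/-- The answer copy: CNOT from the decider's answer wire (its wire `0`) onto the answer wire `k`
(no operation if the decider has no wires). [cite: BennettBernsteinBrassardVazirani1997, Thm. 4.14 (proof: copying the answer to another track)] -/
def ansOps (k d : ℕ) : List (RevOp (W k d)) :=
  if h : 0 < k + d then [RevOp.cnot (dE k d ⟨0, h⟩) (bW k d) (bW_ne_dE _).symm] else []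

/-- **The tidy block** around the decider `D`: copy the query, run `D` on the copy and its
ancillas, copy the answer onto the answer wire, run `D⁻¹`, uncopy.
[cite: BennettBernsteinBrassardVazirani1997, Thm. 4.14 (proof)] -/
def tidyGates (D : QCircuit cliffordT (k + d)) : List (QGate cliffordT (W k d)) :=
  revCompile (copyOps k d) ++ ((mapWires (dE k d) D).gates ++ (revCompile (ansOps k d) ++
    ((mapWires (dE k d) D.inv).gates ++ revCompile (copyOps k d))))

/-- The tidy block as a circuit on `(k + 1) + (k + d)` wires. [cite: BennettBernsteinBrassardVazirani1997, Thm. 4.14] -/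
def tidyCirc (D : QCircuit cliffordT (k + d)) : QCircuit cliffordT (k + 1 + (k + d)) := ⟨tidyGates D⟩

/-- The tidy block is oracle-free if the decider is. [folklore] -/
theorem tidyCirc_isOracleFree {D : QCircuit cliffordT (k + d)} (hD : D.IsOracleFree) :
    (tidyCirc D).IsOracleFree := by
  intro g hg
  simp only [tidyCirc, tidyGates, List.mem_append] at hg
  rcases hg with hg | hg | hg | hg | hg
  · exact revCompile_isOracleFree _ g hg
  · exact isOracleFree_mapWires _ hD g hg
  · exact revCompile_isOracleFree _ g hg
  · exact isOracleFree_mapWires _ (QCircuit.inv_isOracleFree hD) g hg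
  · exact revCompile_isOracleFree _ g hg

/-- The size of the tidy block: at most `2 · 24k + 24 + 8 · size D` gates. [folklore] -/
theorem size_tidyCirc_le (D : QCircuit cliffordT (k + d)) :
    (tidyCirc D).size ≤ 48 * k + 24 + 8 * D.size := by
  have h1 := length_revCompile_le (copyOps k d)
  have h2 := length_revCompile_le (ansOps k d)
  have h3 := D.size_inv_le
  have hc : (copyOps k d).length = k := by simp [copyOps, copyOpsOf]
  have ha : (ansOps k d).length ≤ 1 := by unfold ansOps; split_ifs <;> simp
  simp only [tidyCirc, tidyGates, QCircuit.size, List.length_append, gates_mapWires, List.length_map] at *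
  omega

/-! ### Classical semantics of the copy and of the answer copy -/

/-- XOR the query bits indexed by `l` into the copy register. [folklore] -/
def xorOn : List (Fin k) → QReg k → QReg (k + d) → QReg (k + d)
  | [], _, f => f
  | i :: l, q, f => xorOn l q (Function.update f (Fin.castAdd d i) (f (Fin.castAdd d i) ^^ q i))

/-- The copy operations act on `reg q b f` by `xorOn` on the decider register. [folklore] -/
theorem revEval_copyOpsOf (l : List (Fin k)) (q : QReg k) (b : Bool) (f : QReg (k + d)) :
    revEval (copyOpsOf (d := d) l) (reg q b f) = reg q b (xorOn l q f) := by
  induction l generalizing f with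
  | nil => rfl
  | cons i l ih =>
    change revEval (copyOpsOf l) (RevOp.eval _ (reg q b f)) = _
    rw [RevOp.eval, reg_qW, reg_dE, update_reg_dE]
    exact ih _

/-- The mask XORed into the copy register: `q` on the wires indexed by `l`. [folklore] -/
def mask (l : List (Fin k)) (q : QReg k) (j : Fin (k + d)) : Bool :=
  if h : (j : ℕ) < k then (if (⟨j, h⟩ : Fin k) ∈ l then q ⟨j, h⟩ else false) else false

/-- `xorOn` along a duplicate-free list XORs the mask. [folklore] -/
theorem xorOn_eq_of_nodup {l : List (Fin k)} (hl : l.Nodup) (q : QReg k) (f : QReg (k + d)) :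
    xorOn l q f = fun j => f j ^^ mask l q j := by
  induction l generalizing f with
  | nil => funext j; simp [xorOn, mask]
  | cons i l ih =>
    rw [List.nodup_cons] at hl
    rw [xorOn, ih hl.2]
    funext j
    by_cases hj : j = Fin.castAdd d i
    · subst hj
      have hi : ((Fin.castAdd d i : Fin (k + d)) : ℕ) < k := i.isLt
      have hii : (⟨((Fin.castAdd d i : Fin (k + d)) : ℕ), hi⟩ : Fin k) = i := Fin.ext rfl
      simp only [Function.update_self, mask, dif_pos hi, hii, if_neg hl.1, List.mem_cons, true_or, if_true,
        Bool.xor_false]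
    · rw [Function.update_of_ne hj]
      simp only [mask]
      by_cases h : (j : ℕ) < k
      · have hne : (⟨j, h⟩ : Fin k) ≠ i := fun h' => hj (Fin.ext (by rw [← h']; rfl))
        simp only [dif_pos h, List.mem_cons, hne, false_or]
      · simp only [dif_neg h]

/-- The full mask is the padded query. [folklore] -/
theorem mask_finRange (q : QReg k) : mask (d := d) (List.finRange k) q = padInput q d := by
  funext j
  simp only [mask, List.mem_finRange, if_true]
  induction j using Fin.addCases with
  | left i =>
    rw [padInput, Fin.append_left, dif_pos (by exact i.isLt)]
    rfl
  | right i =>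
    rw [padInput, Fin.append_right, dif_neg (by simp)]

/-- **The copy on a register**: XOR the (padded) query into the decider register. [folklore] -/
theorem revEval_copyOps (q : QReg k) (b : Bool) (f : QReg (k + d)) :
    revEval (copyOps k d) (reg q b f) = reg q b (fun j => f j ^^ padInput q d j) := by
  rw [copyOps, revEval_copyOpsOf, xorOn_eq_of_nodup (List.nodup_finRange k), mask_finRange]

/-- The copy on a clean register writes the padded query. [folklore] -/
theorem revEval_copyOps_zero (q : QReg k) (b : Bool) :
    revEval (copyOps k d) (reg q b fun _ => false) = reg q b (padInput q d) := by
  rw [revEval_copyOps]; simp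

/-- The copy on a copied register cleans it. [folklore] -/
theorem revEval_copyOps_padInput (q : QReg k) (b : Bool) :
    revEval (copyOps k d) (reg q b (padInput q d)) = reg q b fun _ => false := by
  rw [revEval_copyOps]; simp

/-- The decider's answer bit of a decider-register content (`false` if there is no wire).
[folklore] -/
def ans (f : QReg (k + d)) : Bool := if h : 0 < k + d then f ⟨0, h⟩ else false

/-- **The answer copy on a register**: XOR the decider's answer bit onto the answer wire.
[folklore] -/
theorem revEval_ansOps (q : QReg k) (b : Bool) (f : QReg (k + d)) :
    revEval (ansOps k d) (reg q b f) = reg q (b ^^ ans f) f := by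
  unfold ansOps ans
  split_ifs with h
  · change revEval [] (RevOp.eval _ (reg q b f)) = _
    rw [revEval, RevOp.eval, reg_bW, reg_dE, update_reg_bW]
  · simp [revEval]

/-! ### Norm bookkeeping -/

section Norms

variable {n : ℕ}

/-- `normSq (c • g) = |c|² · normSq g`. [folklore] -/
theorem normSq_smul (c : ℂ) (g : QReg n → ℂ) : normSq (c • g) = ‖c‖ ^ 2 * normSq g := by
  simp only [normSq, Pi.smul_apply, smul_eq_mul, norm_mul, mul_pow, Finset.mul_sum]

/-- Squared norm of a difference of disjointly supported vectors. [folklore] -/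
theorem normSq_sub_of_disjoint {g₁ g₂ : QReg n → ℂ} (h : ∀ z, g₁ z = 0 ∨ g₂ z = 0) :
    normSq (g₁ - g₂) = normSq g₁ + normSq g₂ := by
  simp only [normSq, ← Finset.sum_add_distrib]
  refine Finset.sum_congr rfl fun z _ => ?_
  rcases h z with hz | hz <;> simp [hz]

/-- Squared modulus of a sum of pairwise "disjoint" scalars (at most one is nonzero). [folklore] -/
theorem normSq_sum_scalar_of_disjoint {ι : Type*} [Fintype ι] [DecidableEq ι] (a : ι → ℂ)
    (h : ∀ i j, i ≠ j → a i = 0 ∨ a j = 0) : ‖∑ i, a i‖ ^ 2 = ∑ i, ‖a i‖ ^ 2 := by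
  by_cases hex : ∃ i₀, a i₀ ≠ 0
  · obtain ⟨i₀, hi₀⟩ := hex
    have hz : ∀ j, j ≠ i₀ → a j = 0 := fun j hj => (h j i₀ hj).resolve_right hi₀
    rw [Finset.sum_eq_single i₀ (fun j _ hj => hz j hj) (fun h => absurd (Finset.mem_univ _) h),
      Finset.sum_eq_single i₀ (fun j _ hj => by rw [hz j hj]; simp) (fun h => absurd (Finset.mem_univ _) h)]
  · push Not at hex
    simp [hex]

/-- **Pythagoras for disjointly supported vectors**: `‖Σᵢ gᵢ‖² = Σᵢ ‖gᵢ‖²`. [folklore] -/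
theorem normSq_sum_of_disjoint {ι : Type*} [Fintype ι] [DecidableEq ι] (g : ι → QReg n → ℂ)
    (h : ∀ i j z, i ≠ j → g i z = 0 ∨ g j z = 0) : normSq (∑ i, g i) = ∑ i, normSq (g i) := by
  simp only [normSq, Finset.sum_apply]
  rw [Finset.sum_comm]
  refine Finset.sum_congr rfl fun z _ => ?_
  exact normSq_sum_scalar_of_disjoint (fun i => g i z) fun i j hij => h i j z hij

/-- `|a − b|² ≤ 2 (|a|² + |b|²)`. [folklore] -/
theorem norm_sub_sq_le (a b : ℂ) : ‖a - b‖ ^ 2 ≤ 2 * (‖a‖ ^ 2 + ‖b‖ ^ 2) := by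
  have h1 : ‖a - b‖ ≤ ‖a‖ + ‖b‖ := norm_sub_le a b
  have h2 : 0 ≤ ‖a - b‖ := norm_nonneg _
  nlinarith [sq_nonneg (‖a‖ - ‖b‖), h1, h2, norm_nonneg a, norm_nonneg b]

/-- A block state is linear in its block factor: `|c⟩ ⊗ M φ = Σ_f φ(f) · (|c⟩ ⊗ M|f⟩)`. [folklore] -/
theorem restBlockState_mulVec_eq_sum {b W : ℕ} (E : Fin b ↪ Fin W) (M : Matrix (QReg b) (QReg b) ℂ)
    (φ : QReg b → ℂ) (c : QReg W) :
    restBlockState E (M *ᵥ φ) c = ∑ f, φ f • restBlockState E (M *ᵥ basisState f) c := by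
  funext z
  simp only [restBlockState_apply, Finset.sum_apply, Pi.smul_apply, smul_eq_mul]
  by_cases hz : AgreeOff E z c
  · simp only [if_pos hz, mulVec_basisState]
    simp only [Matrix.mulVec, dotProduct]
    exact Finset.sum_congr rfl fun f _ => mul_comm _ _
  · simp [if_neg hz]

end Norms

/-! ### The pieces of the tidy block as matrices -/

section Pieces

variable (A : Language Bool) (D : QCircuit cliffordT (k + d))

/-- The answer bit of the language on the query `q`. [folklore] -/
def abit (A : Language Bool) (q : QReg k) : Bool := A.boolIndicator (List.ofFn q)

/-- The all-zero content of the decider register. [folklore] -/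
def zf (k d : ℕ) : QReg (k + d) := fun _ => false

/-- `zf` reads `0` everywhere (definitional). [folklore] -/
@[simp] theorem zf_apply (j : Fin (k + d)) : zf k d j = false := rfl

/-- The matrix of the copy. [folklore] -/
abbrev Mc (k d : ℕ) : Matrix (QReg (W k d)) (QReg (W k d)) ℂ :=
  (⟨revCompile (copyOps k d)⟩ : QCircuit cliffordT (W k d)).toMatrix 0

/-- The matrix of the answer copy. [folklore] -/
abbrev Ma (k d : ℕ) : Matrix (QReg (W k d)) (QReg (W k d)) ℂ :=
  (⟨revCompile (ansOps k d)⟩ : QCircuit cliffordT (W k d)).toMatrix 0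

/-- The placed decider. [folklore] -/
abbrev Ud (D : QCircuit cliffordT (k + d)) : Matrix (QReg (W k d)) (QReg (W k d)) ℂ :=
  (mapWires (dE k d) D).toMatrix 0

/-- The placed inverse decider. [folklore] -/
abbrev Vd (D : QCircuit cliffordT (k + d)) : Matrix (QReg (W k d)) (QReg (W k d)) ℂ :=
  (mapWires (dE k d) D.inv).toMatrix 0

/-- The ideal gate: the XOR query gate of `A` on the first `k + 1` wires. [folklore] -/
abbrev ideal (A : Language Bool) (k d : ℕ) : Matrix (QReg (W k d)) (QReg (W k d)) ℂ :=
  placeGate (Fin.castAddEmb (k + d)) (oracleGate A k)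

/-- The matrix of the tidy block factors as copy · `D⁻¹` · answer copy · `D` · copy. [folklore] -/
theorem tidyCirc_mat : (tidyCirc D).mat = Mc k d * Vd D * Ma k d * Ud D * Mc k d := by
  change QCircuit.toMatrix 0 (⟨tidyGates D⟩ : QCircuit cliffordT (W k d)) = _
  unfold tidyGates
  rw [show (⟨revCompile (copyOps k d) ++ ((mapWires (dE k d) D).gates ++ (revCompile (ansOps k d) ++
      ((mapWires (dE k d) D.inv).gates ++ revCompile (copyOps k d))))⟩ : QCircuit cliffordT (W k d)) =
      (⟨revCompile (copyOps k d)⟩ : QCircuit cliffordT (W k d)).append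
        ((mapWires (dE k d) D).append ((⟨revCompile (ansOps k d)⟩ : QCircuit cliffordT (W k d)).append
          ((mapWires (dE k d) D.inv).append ⟨revCompile (copyOps k d)⟩))) from rfl]
  simp only [QCircuit.toMatrix_append, Matrix.mul_assoc]

/-- The copy is a basis map. [folklore] -/
theorem isBasisMap_Mc : IsBasisMap (Mc k d) (revEval (copyOps k d)) := fun z =>
  revCompile_mulVec_basisState 0 _ z

/-- The answer copy is a basis map. [folklore] -/
theorem isBasisMap_Ma : IsBasisMap (Ma k d) (revEval (ansOps k d)) := fun z =>
  revCompile_mulVec_basisState 0 _ z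

/-- **The ideal gate on a register**: XOR `[q ∈ A]` onto the answer wire. [cite: NielsenChuang2010, §6.1.1 Eq. (6.2)] -/
theorem ideal_mulVec_basisState (q : QReg k) (b : Bool) (f : QReg (k + d)) :
    ideal A k d *ᵥ basisState (reg q b f) = basisState (reg q (b ^^ abit A q) f) := by
  rw [placeGate_oracleGate_mulVec_basisState]
  congr 1
  unfold oracleTarget queryOf
  have h1 : (Fin.castAddEmb (k + d)) (Fin.last k) = bW k d := rfl
  have h2 : (List.ofFn fun i : Fin k => reg q b f ((Fin.castAddEmb (k + d)) i.castSucc)) = List.ofFn q :=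
    congrArg List.ofFn (funext fun i => reg_qW q b f i)
  rw [h1, h2, reg_bW, update_reg_bW]
  rfl

/-- **The copy on a register.** [folklore] -/
theorem Mc_mulVec_basisState (q : QReg k) (b : Bool) (f : QReg (k + d)) :
    Mc k d *ᵥ basisState (reg q b f) = basisState (reg q b fun j => f j ^^ padInput q d j) := by
  rw [isBasisMap_Mc, revEval_copyOps]

/-- The copy is an involution on registers. [folklore] -/
theorem revEval_copyOps_copyOps (z : QReg (W k d)) :
    revEval (copyOps k d) (revEval (copyOps k d) z) = z := by
  rw [← reg_eta z, revEval_copyOps, revEval_copyOps]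
  congr 1
  funext j
  rw [Bool.xor_assoc, Bool.xor_self, Bool.xor_false]

/-- The copy applied twice is the identity. [folklore] -/
theorem Mc_mulVec_Mc_mulVec (v : QReg (W k d) → ℂ) : Mc k d *ᵥ (Mc k d *ᵥ v) = v := by
  rw [Matrix.mulVec_mulVec]
  exact ((isBasisMap_Mc (k := k) (d := d)).mul isBasisMap_Mc).mulVec_eq_self fun z _ =>
    revEval_copyOps_copyOps z

/-- The copy preserves the norm. [folklore] -/
theorem normSq_Mc_mulVec (v : QReg (W k d) → ℂ) : normSq (Mc k d *ᵥ v) = normSq v :=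
  normSq_mulVec_of_mem_unitaryGroup (QCircuit.toMatrix_mem_unitaryGroup_holds cliffordT_isUnitary_holds 0 _) v

/-- **The placed decider acts on the block factor.** [cite: NielsenChuang2010, §2.1.7 eq. (2.45)] -/
theorem Ud_mulVec_restBlockState (φ : QReg (k + d) → ℂ) (c : QReg (W k d)) :
    Ud D *ᵥ restBlockState (dE k d) φ c = restBlockState (dE k d) (D.mat *ᵥ φ) c := by
  dsimp only [Ud]
  rw [toMatrix_mapWires, placeGate_mulVec_restBlockState]

/-- **The placed inverse decider acts on the block factor.** [cite: NielsenChuang2010, §2.1.7 eq. (2.45)] -/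
theorem Vd_mulVec_restBlockState (φ : QReg (k + d) → ℂ) (c : QReg (W k d)) :
    Vd D *ᵥ restBlockState (dE k d) φ c = restBlockState (dE k d) (D.inv.mat *ᵥ φ) c := by
  dsimp only [Vd]
  rw [toMatrix_mapWires, placeGate_mulVec_restBlockState]

/-- A basis register as a block state over its clean rest. [folklore] -/
theorem basisState_reg_eq (q : QReg k) (b : Bool) (f g : QReg (k + d)) :
    basisState (reg q b f) = restBlockState (dE k d) (basisState f) (reg q b g) := by
  rw [restBlockState_basisState, extend_dE_reg]

/-- **The answer copy on a block state**: the branch superposition indexed by the decider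
register, the answer bit XORed onto the answer wire.
[cite: BennettBernsteinBrassardVazirani1997, Thm. 4.14 (proof: copy the answer)] -/
theorem Ma_mulVec_restBlockState (φ : QReg (k + d) → ℂ) (q : QReg k) (b : Bool) (g : QReg (k + d)) :
    Ma k d *ᵥ restBlockState (dE k d) φ (reg q b g) = ∑ f, φ f • basisState (reg q (b ^^ ans f) f) := by
  have h := (isBasisMap_Ma (k := k) (d := d)).mulVec_restBlockState_of_extend (dE k d)
    (fun f c => Function.update c (bW k d) (c (bW k d) ^^ ans f)) (fun f c => by
      conv_lhs => rw [← reg_eta c, extend_dE_reg, revEval_ansOps]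
      conv_rhs => rw [← reg_eta c, update_reg_bW, reg_bW, extend_dE_reg]) φ (reg q b g)
  rw [h]
  refine Finset.sum_congr rfl fun f _ => ?_
  rw [reg_bW, update_reg_bW, extend_dE_reg]

end Pieces

/-! ### The compute–copy–uncompute computation -/

section Main

variable (A : Language Bool) (D : QCircuit cliffordT (k + d))

/-- The projection onto the decider outputs whose answer bit is `a`. [folklore] -/
def proj (a : Bool) (φ : QReg (k + d) → ℂ) : QReg (k + d) → ℂ := fun f => if ans f = a then φ f else 0

/-- The decider's output state on the classical query `q`: `D |q 0^d⟩`. [folklore] -/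
def ψD (D : QCircuit cliffordT (k + d)) (q : QReg k) : QReg (k + d) → ℂ := D.mat *ᵥ basisState (padInput q d)

/-- **The error probability of the decider on `q`**: the Born weight of the outputs whose answer
bit (wire `0`) differs from `[q ∈ A]`. [cite: BennettBernsteinBrassardVazirani1997, Def. 4.12 and Thm. 4.14] -/
def errProb (q : QReg k) : ℝ := normSq (proj (!abit A q) (ψD D q))

/-- The error vector `v_q = D⁻¹ (wrong part of D|q 0⟩)`. [cite: BennettBernsteinBrassardVazirani1997, Thm. 4.14 (proof)] -/
def errVec (q : QReg k) : QReg (k + d) → ℂ := D.inv.mat *ᵥ proj (!abit A q) (ψD D q)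

/-- `‖v_q‖²` is the error probability (the inverse decider is unitary). [folklore] -/
theorem normSq_errVec (q : QReg k) : normSq (errVec A D q) = errProb A D q :=
  normSq_mulVec_of_mem_unitaryGroup (QCircuit.toMatrix_mem_unitaryGroup_holds cliffordT_isUnitary_holds 0 _) _

/-- The error probability is nonnegative. [folklore] -/
theorem errProb_nonneg (q : QReg k) : 0 ≤ errProb A D q := Finset.sum_nonneg fun _ _ => by positivity

/-- The error probability as a Born sum over the wrong outputs. [folklore] -/
theorem errProb_eq_sum (q : QReg k) :
    errProb A D q = ∑ f, if ans f = !abit A q then ‖ψD D q f‖ ^ 2 else 0 := by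
  unfold errProb normSq proj
  exact Finset.sum_congr rfl fun f _ => by split_ifs <;> simp

/-- The right part is the whole minus the wrong part. [folklore] -/
theorem proj_eq_sub (a : Bool) (φ : QReg (k + d) → ℂ) : proj a φ = φ - proj (!a) φ := by
  funext f
  simp only [proj, Pi.sub_apply]
  cases a <;> cases ans f <;> simp

/-- Block states are additive in the block factor. [folklore] -/
theorem restBlockState_sub {b' W' : ℕ} (E : Fin b' ↪ Fin W') (φ φ' : QReg b' → ℂ) (c : QReg W') :
    restBlockState E (φ - φ') c = restBlockState E φ c - restBlockState E φ' c := by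
  funext z
  simp only [restBlockState_apply, Pi.sub_apply]
  split_ifs <;> simp

/-- A sum over `Bool` split at a given bit. [folklore] -/
theorem sum_bool_eq {M : Type*} [AddCommMonoid M] (G : Bool → M) (c : Bool) : ∑ a, G a = G c + G (!c) := by
  rw [Fintype.sum_bool]
  cases c
  · rw [add_comm]; rfl
  · rfl

/-- The decider undone: `D⁻¹ (D |q 0⟩) = |q 0⟩`. [folklore] -/
theorem inv_mulVec_ψD (q : QReg k) : D.inv.mat *ᵥ ψD D q = basisState (padInput q d) :=
  D.inv_mulVec_mulVec 0 _

/-- **Run, copy the answer, reverse** on the copied register `|q, b, q 0^d⟩`: the clean target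
`|q, b ⊕ [q ∈ A], q 0^d⟩` minus/plus the error vector attached to the two answer values.
[cite: BennettBernsteinBrassardVazirani1997, Thm. 4.14 (proof)] -/
theorem mid_mulVec_basisState (q : QReg k) (b : Bool) :
    Vd D *ᵥ (Ma k d *ᵥ (Ud D *ᵥ basisState (reg q b (padInput q d)))) =
      basisState (reg q (b ^^ abit A q) (padInput q d))
        - restBlockState (dE k d) (errVec A D q) (reg q (b ^^ abit A q) (zf k d))
        + restBlockState (dE k d) (errVec A D q) (reg q (b ^^ !abit A q) (zf k d)) := by
  rw [basisState_reg_eq q b (padInput q d) (padInput q d), Ud_mulVec_restBlockState,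
    Ma_mulVec_restBlockState, Matrix.mulVec_sum]
  simp_rw [Matrix.mulVec_smul]
  have hterm : ∀ f : QReg (k + d), (D.mat *ᵥ basisState (padInput q d)) f • (Vd D *ᵥ basisState (reg q (b ^^ ans f) f)) =
      ∑ a : Bool, proj a (ψD D q) f • restBlockState (dE k d) (D.inv.mat *ᵥ basisState f) (reg q (b ^^ a) (zf k d)) := by
    intro f
    rw [basisState_reg_eq q (b ^^ ans f) f (zf k d), Vd_mulVec_restBlockState, sum_bool_eq _ (ans f)]
    simp [proj, ψD]
  simp_rw [hterm]
  rw [Finset.sum_comm]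
  simp_rw [← restBlockState_mulVec_eq_sum]
  rw [sum_bool_eq _ (abit A q), proj_eq_sub (abit A q), Matrix.mulVec_sub, inv_mulVec_ψD, restBlockState_sub,
    restBlockState_basisState, extend_dE_reg]
  rfl

/-- The error on the sector of the query `q`: the error vector attached to the wrong answer
minus the error vector attached to the right answer. [folklore] -/
def Δ (q : QReg k) : QReg (W k d) → ℂ :=
  restBlockState (dE k d) (errVec A D q) (reg q (!abit A q) (zf k d))
    - restBlockState (dE k d) (errVec A D q) (reg q (abit A q) (zf k d))

/-- **The sector computation**: on the span of `|q, 0, q 0⟩, |q, 1, q 0⟩` the middle part minus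
the (copied) ideal is `(c₀ − c₁) · Δ_q`. [cite: BennettBernsteinBrassardVazirani1997, Thm. 4.14 (proof)] -/
theorem sector (q : QReg k) (c : Bool → ℂ) :
    Vd D *ᵥ (Ma k d *ᵥ (Ud D *ᵥ ∑ b, c b • basisState (reg q b (padInput q d))))
      - Mc k d *ᵥ (ideal A k d *ᵥ ∑ b, c b • basisState (reg q b (zf k d))) =
      (c false - c true) • Δ A D q := by
  simp only [Fintype.sum_bool, Matrix.mulVec_add, Matrix.mulVec_smul]
  rw [mid_mulVec_basisState A D q true, mid_mulVec_basisState A D q false]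
  simp only [ideal_mulVec_basisState, Mc_mulVec_basisState, zf_apply, Bool.false_xor, Bool.true_xor,
    Bool.not_not, Δ]
  module

/-- `Δ_q` is supported on the registers with query `q`. [folklore] -/
theorem Δ_apply_eq_zero {q : QReg k} {z : QReg (W k d)} (hz : query z ≠ q) : Δ A D q z = 0 := by
  simp only [Δ, Pi.sub_apply, restBlockState_apply]
  rw [if_neg fun h => hz ((agreeOff_reg_iff z q _ _).1 h).1, if_neg fun h => hz ((agreeOff_reg_iff z q _ _).1 h).1,
    sub_zero]

/-- `‖Δ_q‖² = 2 ‖v_q‖² = 2 · errProb q` (the two attached copies have disjoint supports). [folklore] -/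
theorem normSq_Δ (q : QReg k) : normSq (Δ A D q) = 2 * errProb A D q := by
  unfold Δ
  rw [normSq_sub_of_disjoint, two_mul]
  · congr 1 <;> exact (sum_normSq_restBlockState (dE k d) _ _).trans (normSq_errVec A D q)
  · intro z
    simp only [restBlockState_apply]
    by_cases h1 : AgreeOff (dE k d) z (reg q (!abit A q) (zf k d))
    · right
      rw [if_neg]
      intro h2
      have e1 := ((agreeOff_reg_iff z q _ _).1 h1).2
      have e2 := ((agreeOff_reg_iff z q _ _).1 h2).2
      rw [e1] at e2
      exact Bool.not_ne_self _ e2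
    · left; rw [if_neg h1]

/-! ### Clean inputs and the sector decomposition -/

/-- Clean inputs (every wire `≥ k + 1` reads `0`) are the registers `reg q b 0`. [folklore] -/
theorem clean_iff (z : QReg (W k d)) :
    (∀ i : Fin (W k d), k + 1 ≤ (i : ℕ) → z i = false) ↔ z ∘ dE k d = zf k d := by
  constructor
  · intro h
    funext j
    exact h _ (by rw [val_dE]; omega)
  · intro h i hi
    obtain ⟨j, rfl⟩ : ∃ j : Fin (k + d), i = dE k d j :=
      ⟨⟨(i : ℕ) - (k + 1), by have h2 : (i : ℕ) < k + 1 + (k + d) := i.isLt; omega⟩,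
        Fin.ext (by rw [val_dE]; simp only; omega)⟩
    exact congrFun h j

/-- **Sums of functions vanishing off the clean registers** are double sums over query and
answer. [folklore] -/
theorem sum_eq_sum_reg {M : Type*} [AddCommMonoid M] (F : QReg (W k d) → M)
    (hF : ∀ z, z ∘ dE k d ≠ zf k d → F z = 0) : ∑ z, F z = ∑ q : QReg k, ∑ b : Bool, F (reg q b (zf k d)) := by
  classical
  let ι : QReg k × Bool → QReg (W k d) := fun p => reg p.1 p.2 (zf k d)
  have hι : Function.Injective ι := fun p p' h => by
    obtain ⟨h1, h2, -⟩ := (reg_injective_iff _ _ _ _ _ _).1 h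
    exact Prod.ext h1 h2
  rw [← Fintype.sum_prod_type', ← Finset.sum_image (f := F) fun p _ p' _ h => hι h]
  symm
  refine Finset.sum_subset (Finset.subset_univ _) fun z _ hz => hF z fun hzE => hz ?_
  refine Finset.mem_image.2 ⟨(query z, z (bW k d)), Finset.mem_univ _, ?_⟩
  change reg (query z) (z (bW k d)) (zf k d) = z
  rw [← hzE, reg_eta]

/-- **The tidy block implements the query gate on clean inputs up to `2√ε`** (`ε` the worst
classical error probability of the decider): BBBV Thm. 4.14 in amplitude form, for all queries in
superposition at once. [cite: BennettBernsteinBrassardVazirani1997, Thm. 4.14] -/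
theorem tidyCirc_implOn {ε : ℝ} (hε : 0 ≤ ε) (herr : ∀ q, errProb A D q ≤ ε) :
    ImplOn {z : QReg (k + 1 + (k + d)) | ∀ i : Fin (k + 1 + (k + d)), k + 1 ≤ (i : ℕ) → z i = false}
      (tidyCirc D).mat (placeGate (Fin.castAddEmb (k + d)) (oracleGate A k)) (2 * Real.sqrt ε) := by
  intro ψ hψ
  have hψ0 : ∀ z, z ∘ dE k d ≠ zf k d → ψ z = 0 := fun z hz => hψ z fun h => hz ((clean_iff z).1 h)
  -- coefficients and decomposition
  set c : QReg k → Bool → ℂ := fun q b => ψ (reg q b (zf k d)) with hc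
  have hdec : ψ = ∑ q, ∑ b, c q b • basisState (reg q b (zf k d)) := by
    conv_lhs => rw [state_eq_sum_smul_basisState ψ]
    exact sum_eq_sum_reg (fun z => ψ z • basisState z) fun z hz => by rw [hψ0 z hz, zero_smul]
  have hnorm : normSq ψ = ∑ q, ∑ b, ‖c q b‖ ^ 2 :=
    sum_eq_sum_reg (fun z => ‖ψ z‖ ^ 2) fun z hz => by rw [hψ0 z hz]; simp
  -- the copied input
  have hcopy : Mc k d *ᵥ ψ = ∑ q, ∑ b, c q b • basisState (reg q b (padInput q d)) := by
    conv_lhs => rw [hdec]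
    simp only [Matrix.mulVec_sum, Matrix.mulVec_smul, Mc_mulVec_basisState, zf_apply, Bool.false_xor]
  -- the error vector
  have herrvec : (tidyCirc D).mat *ᵥ ψ - ideal A k d *ᵥ ψ =
      Mc k d *ᵥ ∑ q, (c q false - c q true) • Δ A D q := by
    have h1 : (tidyCirc D).mat *ᵥ ψ = Mc k d *ᵥ (Vd D *ᵥ (Ma k d *ᵥ (Ud D *ᵥ (Mc k d *ᵥ ψ)))) := by
      simp only [tidyCirc_mat, ← Matrix.mulVec_mulVec]
    have h2 : ideal A k d *ᵥ ψ = Mc k d *ᵥ (Mc k d *ᵥ (ideal A k d *ᵥ ψ)) := (Mc_mulVec_Mc_mulVec _).symm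
    rw [h1, h2, ← Matrix.mulVec_sub]
    congr 1
    rw [hcopy]
    conv_lhs => rw [hdec]
    simp only [Matrix.mulVec_sum]
    rw [← Finset.sum_sub_distrib]
    refine Finset.sum_congr rfl fun q _ => ?_
    have := sector A D q (c q)
    simp only [Matrix.mulVec_sum] at this
    exact this
  -- its squared norm
  have hns : normSq ((tidyCirc D).mat *ᵥ ψ - ideal A k d *ᵥ ψ) ≤ (2 * Real.sqrt ε) ^ 2 * normSq ψ := by
    rw [herrvec, normSq_Mc_mulVec, normSq_sum_of_disjoint]
    · simp_rw [normSq_smul, normSq_Δ]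
      rw [mul_pow, Real.sq_sqrt hε, hnorm, Finset.mul_sum]
      refine Finset.sum_le_sum fun q _ => ?_
      rw [Fintype.sum_bool]
      have h1 := norm_sub_sq_le (c q false) (c q true)
      have h2 := herr q
      have h3 := errProb_nonneg A D q
      have h4 : 0 ≤ ‖c q false‖ ^ 2 + ‖c q true‖ ^ 2 := by positivity
      nlinarith
    · intro q q' z hqq
      by_cases hz : query z = q
      · right; simp [Δ_apply_eq_zero A D (fun h => hqq (hz.symm.trans h))]
      · left; simp [Δ_apply_eq_zero A D hz]
  exact l2Norm_le_of_normSq_le (mul_nonneg (mul_nonneg zero_le_two (Real.sqrt_nonneg ε)) (l2Norm_nonneg ψ))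
    (by rw [mul_pow, l2Norm_sq]; exact hns)

end Main

end TidyBlock

end Literature.Computability.QuantumComplexity

end
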